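import Summits.QuantumFields.YangMills.Theorems.UnitScaleGibbsActionDerivativeSlotCalculus
import Literature.MathematicalPhysics.QuantumFieldTheory.Balaban1983to89.T4AxialGaugeSmallField
import HarnessLib

/-!
# `UnitScaleGibbsNormalEquationNetFlux` — NO BOX-LOCAL LEAST-SQUARES POTENTIAL CAN MATCH A NET-FLUX WEIGHT
# (an elementary obstruction inside LINE 28 «GrossTransfer», construction C3, stub `stub_linTest`; file 1 of 2)

Cell `ym3-torus` (YM ladder rung R3 = continuum SU(2) Yang–Mills on every three-torus — a RUNG, NOT d = 4, NOT infinite volume,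
NOT a mass gap, NOT the Clay problem), crux of record `UnitScaleTilt.HistoryTailL` (stmt-QuantumFields-19936), width seat
`ym-ust-19936-w5` gen 16.  LINE 28 «GrossTransfer» (skeleton `Cruxes/HistoryTailL/Lines/gross_transfer.lean`, registered on
stmt-QuantumFields-23083) wants, inside its load-bearing stub `stub_linTest`, the IDENTIFICATION (card, verbatim): *«the j-fold (0.4)
average linearises … to a gauge-invariant linear functional `⟨w,A⟩`, `d*w = 0` ⇒ `w = d*h` on the contractible box ⇒ `⟨w,A⟩ = ⟨du⁰,dA⟩`
for the least-squares potential (✓p733604 `exists_box_leastSquares_potential`), tree-gauged»*, with three FIXED test fields supported on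
the INNER, OFF-TREE bonds of a non-wrapping box (margin 1; `lowPart b.dir (x − lo) ≠ 0`); to kill the first-order defect
`D_α = ⟨w − du, dg_α⟩` displayed by the companion brick (LIN-ID) ✓`UnitScaleGibbsLinProxyFluxIdentification` (v1 carried it as the
hypothesis `hN : ∀ B, Σ_p ((du)_p − w_p)·(dB)_p = 0`; v2 displays it as a defect term) a knit needs the NORMAL EQUATIONS
`∀ B, Σ_p ((du)_p − w_p)·(dB)_p = 0`, `(dB)_p := B(slotBond p 0) + B(slotBond p 1) − B(slotBond p 2) − B(slotBond p 3)`, at least for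
the off-tree box-supported `B` (the small-field potentials `g_α` vanish on the axial tree).

THIS FILE PROVES (finite sums on `Plaq P j` / `PBond P j`; nothing probabilistic) that those normal equations have NO box-local
solution when `w` carries net flux:
* §1 DOUBLE COUNTING (`sum_site_curl_eq_zero`, `sum_ite_curl_eq_zero`): for EVERY `B : PBond P j → M` and every orientation `μ < ν`,
  `Σ_{p : p.μ = μ, p.ν = ν} (dB)_p = 0` — the curl of ANY bond field has zero net flux through every orientation.
* §2 THE OFF-TREE LINEAR POTENTIAL (`sum_ite_eq_zero_of_offTree_normalEq`): on a NON-WRAPPING box `[lo, hi]` (`hi κ − lo κ < sitesPerDir j`)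
  the bond field `A(⟨castSite x, ν⟩) := x_μ − lo_μ` on box bonds of direction `ν` (`μ < ν`), `0` elsewhere, is supported on OFF-TREE box bonds
  in the skeleton's letters and has `(dA)_p = [p ∥ (μ,ν)]` on every box plaquette.  HENCE: if `r : Plaq P j → ℝ` is supported in
  `boxPlaqs lo hi` and pairs to zero with the curl of every off-tree box-supported `B` (a fortiori with the curl of EVERY `B`: `hN`), then
  EVERY ORIENTATION SUM of `r` vanishes.
* §3 THE OBSTRUCTION (`not_offTree_normalEq_of_orientationSum_ne_zero`, `not_normalEq_of_orientationSum_ne_zero`, `not_normalEq_of_margin`):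
  for `w` supported in `boxPlaqs lo hi` with `Σ_{p ∥ (μ,ν)} w_p ≠ 0` and ANY `u : PBond P j → ℝ` whose curl is supported in `boxPlaqs lo hi`
  (e.g. the skeleton's margin-1 support row — `curl_support_of_margin`), the normal equations — `hN`, and equally the off-tree weakening a box
  least-squares projection would supply — are FALSE.
File 2 (`UnitScaleGibbsNormalEquationNetFluxLinWeight`) instantiates `w := linWeight j a` (net flux `(L·L)^j ≠ 0`, ✓`sum_linWeight`).

WHY IT MATTERS (honest reading).  Gross's Schwinger–Dyson observables `Y_α = (∂_{u_α} A_W)(V)` pair the (dressed) field with the CURL `du_α`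
of a FIXED test field; with `u_α` box-local, `du_α` has zero net flux through every orientation (§1), whereas the block plaquette's linear
proxy carries net flux `(L²)^j`.  No choice of box, tree root, margin or least-squares problem makes `⟨w − du⁰, dB⟩ ≡ 0`: the designed
identification of `stub_linTest` has no instance.  (✓p733604/✓p736122 is NOT in contradiction: there `u` lives on ALL inner bonds of the
block, so its torus curl leaks to the plaquettes sticking out of the block — outside `boxPlaqs` — carrying the return circulation `−Σ w` by §1.)

WHAT THIS IS NOT.  It does NOT refute `stub_linTest` (an `∃`-statement trivially implied by the line's own conclusion «ShallowFluxSecondMomentL»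
with `u := 0`), nor any stub or registered item; it records an elementary lattice identity and its consequence for the line's MECHANISM.
Nothing of (Q), 23083/23133/23134, K1, `HistoryTailL` or the rung is proved.  YM₃ on T³ is rung R3 — NOT d = 4, NOT a mass gap, NOT Clay.

References: L. Gross, CMP **92** (1983) 137–162 [GrossCMP1983] (Thm 2.2: Gaussian domination for the fluxes of EXACT test 2-forms `dh`);
T. Bałaban, CMP **98** (1985) 17–51 [Balaban1985Averaging] ((5) p.18: bonds and plaquettes of `T^{(j)}`).
-/

set_option autoImplicit false

noncomputable section

open scoped BigOperators
open Literature.MathematicalPhysics.QuantumFieldTheory.Balaban1983to89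
open Literature.MathematicalPhysics.QuantumFieldTheory.Balaban1983to89.T4AxialGaugeSmallField (castSite castSite_add_e
  castSite_injOn_box boxPlaqs)
open Literature.MathematicalPhysics.QuantumFieldTheory.Balaban1983to89.B7Prop1Explicit (e e_apply)
open Literature.MathematicalPhysics.QuantumFieldTheory.Balaban1983to89.B8Lemma1NonAbelian (lowPart lowPart_apply e_nonneg)
open Summit.QuantumFields.YangMills.Theorems.UnitScaleGibbsActionDerivativeSlotCalculus (slotBond)

namespace Summit.QuantumFields.YangMills.Theorems.UnitScaleGibbsNormalEquationNetFlux

variable {P : Params} {j : ℕ}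

/-! ## §1  Double counting: the curl of any bond field has zero net flux through every orientation -/

/-- The four slot bonds of the plaquette `⟨x, μ, ν⟩`, read by a bond field: `(dB)_p = B⟨x,μ⟩ + B⟨x+e_μ,ν⟩ − B⟨x+e_ν,μ⟩ − B⟨x,ν⟩`
(bookkeeping for ✓`slotBond`). [folklore] -/
theorem curl_slotBond_eq {M : Type*} [AddCommGroup M] (B : PBond P j → M) (p : Plaq P j) :
    B (slotBond p 0) + B (slotBond p 1) - B (slotBond p 2) - B (slotBond p 3) =
      B ⟨p.src, p.μ⟩ + B ⟨p.src.shift p.μ, p.ν⟩ - B ⟨p.src.shift p.ν, p.μ⟩ - B ⟨p.src, p.ν⟩ := by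
  simp [slotBond]

/-- Translation by `e_κ` is a bijection of the torus, so `Σ_x g(x + e_κ) = Σ_x g(x)`. [folklore] -/
theorem sum_shift_eq {M : Type*} [AddCommMonoid M] (κ : Fin P.d) (g : Site P j → M) :
    ∑ x : Site P j, g (x.shift κ) = ∑ x : Site P j, g x := by
  refine Fintype.sum_equiv ⟨fun x => x.shift κ, fun x => x.unshift κ, ?_, ?_⟩ _ _ (fun _ => rfl)
  · intro x
    funext i
    by_cases hi : i = κ
    · subst hi; simp [Site.shift, Site.unshift]
    · simp [Site.shift, Site.unshift, Function.update_of_ne hi]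
  · intro x
    funext i
    by_cases hi : i = κ
    · subst hi; simp [Site.shift, Site.unshift]
    · simp [Site.shift, Site.unshift, Function.update_of_ne hi]

/-- **DOUBLE COUNTING, site-indexed form**: for every bond field `B` and every pair of directions `μ, ν`,
`Σ_x (B⟨x,μ⟩ + B⟨x+e_μ,ν⟩ − B⟨x+e_ν,μ⟩ − B⟨x,ν⟩) = 0` — each bond enters once with each sign. [folklore] -/
theorem sum_site_curl_eq_zero {M : Type*} [AddCommGroup M] (B : PBond P j → M) (μ ν : Fin P.d) :
    ∑ x : Site P j, (B ⟨x, μ⟩ + B ⟨x.shift μ, ν⟩ - B ⟨x.shift ν, μ⟩ - B ⟨x, ν⟩) = 0 := by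
  simp only [Finset.sum_sub_distrib, Finset.sum_add_distrib]
  rw [sum_shift_eq μ (fun y => B ⟨y, ν⟩), sum_shift_eq ν (fun y => B ⟨y, μ⟩)]
  abel

/-- An orientation class of plaquettes is indexed by its base points: `Σ_p [p.μ = μ ∧ p.ν = ν]·f p = Σ_x f ⟨x, μ, ν⟩`. [folklore] -/
theorem sum_ite_orientation_eq_sum_site {M : Type*} [AddCommMonoid M] (f : Plaq P j → M) {μ ν : Fin P.d} (h : μ < ν) :
    ∑ p : Plaq P j, (if p.μ = μ ∧ p.ν = ν then f p else 0) = ∑ x : Site P j, f ⟨x, μ, ν, h⟩ := by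
  classical
  set mk : Site P j → Plaq P j := fun x => ⟨x, μ, ν, h⟩ with hmk
  have hinj : ∀ x ∈ (Finset.univ : Finset (Site P j)), ∀ y ∈ (Finset.univ : Finset (Site P j)), mk x = mk y → x = y := by
    intro x _ y _ hxy
    simpa [hmk] using congrArg Plaq.src hxy
  have h1 : ∑ p : Plaq P j, (if p.μ = μ ∧ p.ν = ν then f p else 0) =
      ∑ p ∈ Finset.univ.image mk, (if p.μ = μ ∧ p.ν = ν then f p else 0) := by
    refine (Finset.sum_subset (Finset.subset_univ _) fun p _ hp => ?_).symm
    rw [if_neg]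
    rintro ⟨h1, h2⟩
    apply hp
    refine Finset.mem_image.2 ⟨p.src, Finset.mem_univ _, ?_⟩
    cases p
    simp only at h1 h2
    subst h1
    subst h2
    rfl
  rw [h1, Finset.sum_image hinj]
  refine Finset.sum_congr rfl fun x _ => ?_
  rw [if_pos ⟨rfl, rfl⟩]

/-- **DOUBLE COUNTING, in the `slotBond` letters of `stub_linTest` / (LIN-ID)**: the orientation sum of the curl of ANY bond field
vanishes, `Σ_{p : p.μ = μ, p.ν = ν} (dB)_p = 0`.  In particular the curl `du` of a test field has zero NET FLUX through every
orientation — whatever its support. [folklore] -/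
theorem sum_ite_curl_eq_zero {M : Type*} [AddCommGroup M] (B : PBond P j → M) {μ ν : Fin P.d} (h : μ < ν) :
    ∑ p : Plaq P j, (if p.μ = μ ∧ p.ν = ν then
        B (slotBond p 0) + B (slotBond p 1) - B (slotBond p 2) - B (slotBond p 3) else 0) = 0 := by
  rw [sum_ite_orientation_eq_sum_site _ h]
  simp only [curl_slotBond_eq]
  exact sum_site_curl_eq_zero B μ ν

/-! ## §2  The off-tree linear potential on a non-wrapping box and the vanishing of orientation sums -/

/-- ★★★ **ORIENTATION SUMS VANISH UNDER THE OFF-TREE NORMAL EQUATIONS.**  Let `[lo, hi]` be a non-wrapping box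
(`hi κ − lo κ < sitesPerDir j`), `r : Plaq P j → ℝ` supported in `boxPlaqs lo hi`, and suppose `r` pairs to zero with the curl of
every bond field `B` supported on OFF-TREE BOX bonds in the letters of `stub_linTest` (`B b ≠ 0 → ∃ x, lo ≤ x ∧ x + e_{b.dir} ≤ hi ∧
b.src = castSite x ∧ lowPart b.dir (x − lo) ≠ 0`).  Then every orientation sum of `r` vanishes.  PROOF: test against the linear potential
`A(⟨castSite x, ν⟩) = x_μ − lo_μ` (`μ < ν`; off-tree because a direction-`ν` tree bond has `x_μ = lo_μ`), whose curl on box plaquettes is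
the indicator of the orientation `(μ, ν)`. [folklore] -/
theorem sum_ite_eq_zero_of_offTree_normalEq {lo hi : Fin P.d → ℤ} (hN : ∀ κ, hi κ - lo κ < P.sitesPerDir j)
    (r : Plaq P j → ℝ) (hr : ∀ p, r p ≠ 0 → p ∈ boxPlaqs lo hi)
    (H : ∀ B : PBond P j → ℝ,
      (∀ b, B b ≠ 0 → ∃ x : Fin P.d → ℤ, lo ≤ x ∧ x + e b.dir ≤ hi ∧ b.src = castSite x ∧ lowPart b.dir (x - lo) ≠ 0) →
      ∑ p : Plaq P j, r p * (B (slotBond p 0) + B (slotBond p 1) - B (slotBond p 2) - B (slotBond p 3)) = 0)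
    {μ ν : Fin P.d} (hμν : μ < ν) :
    ∑ p : Plaq P j, (if p.μ = μ ∧ p.ν = ν then r p else 0) = 0 := by
  classical
  -- the off-tree linear potential
  let A : PBond P j → ℝ := fun b =>
    if h : ∃ x : Fin P.d → ℤ, lo ≤ x ∧ x + e b.dir ≤ hi ∧ b.src = castSite x ∧ b.dir = ν
    then (((Classical.choose h) μ - lo μ : ℤ) : ℝ) else 0
  have hle_of_add : ∀ (x : Fin P.d → ℤ) (κ : Fin P.d), x + e κ ≤ hi → x ≤ hi :=
    fun x κ hx => le_trans (le_add_of_nonneg_right (e_nonneg κ)) hx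
  -- its value on the box bonds of direction `ν`
  have hA_val : ∀ x : Fin P.d → ℤ, lo ≤ x → x + e ν ≤ hi → A ⟨castSite x, ν⟩ = ((x μ - lo μ : ℤ) : ℝ) := by
    intro x hx hxν
    have h : ∃ x' : Fin P.d → ℤ, lo ≤ x' ∧ x' + e ν ≤ hi ∧ (castSite x : Site P j) = castSite x' ∧ ν = ν :=
      ⟨x, hx, hxν, rfl, rfl⟩
    simp only [A, dif_pos h]
    obtain ⟨h1, h2, h3, -⟩ := Classical.choose_spec h
    have hxx : x = Classical.choose h :=
      castSite_injOn_box hN hx (hle_of_add x ν hxν) h1 (hle_of_add _ ν h2) h3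
    rw [← hxx]
  -- it vanishes on bonds of other directions
  have hA_dir : ∀ b : PBond P j, b.dir ≠ ν → A b = 0 := by
    intro b hb
    have h : ¬ ∃ x : Fin P.d → ℤ, lo ≤ x ∧ x + e b.dir ≤ hi ∧ b.src = castSite x ∧ b.dir = ν :=
      fun ⟨_, _, _, _, h4⟩ => hb h4
    simp only [A, dif_neg h]
  -- it is supported on off-tree box bonds
  have hA_off : ∀ b, A b ≠ 0 → ∃ x : Fin P.d → ℤ, lo ≤ x ∧ x + e b.dir ≤ hi ∧ b.src = castSite x ∧ lowPart b.dir (x - lo) ≠ 0 := by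
    intro b hb
    by_cases h : ∃ x : Fin P.d → ℤ, lo ≤ x ∧ x + e b.dir ≤ hi ∧ b.src = castSite x ∧ b.dir = ν
    · obtain ⟨x, hx, hxb, hsrc, hdir⟩ := h
      refine ⟨x, hx, hxb, hsrc, fun hlow => hb ?_⟩
      have hμ0 : x μ - lo μ = 0 := by
        have := congr_fun hlow μ
        simpa [lowPart_apply, hdir, hμν] using this
      have hb' : b = ⟨castSite x, ν⟩ := by
        cases b
        simp only at hsrc hdir
        rw [hsrc, hdir]
      rw [hdir] at hxb
      rw [hb', hA_val x hx hxb, hμ0, Int.cast_zero]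
    · exact absurd (by simp only [A, dif_neg h]) hb
  -- its curl on a box plaquette is the orientation indicator
  have hcurl : ∀ p : Plaq P j, p ∈ boxPlaqs lo hi →
      A (slotBond p 0) + A (slotBond p 1) - A (slotBond p 2) - A (slotBond p 3) = if p.μ = μ ∧ p.ν = ν then 1 else 0 := by
    intro p hp
    obtain ⟨z, hz, hzhi, hsrc⟩ := hp
    rw [curl_slotBond_eq]
    obtain ⟨src, pμ, pν, hpμν⟩ := p
    simp only at hsrc hzhi hpμν ⊢
    subst hsrc
    rw [← castSite_add_e, ← castSite_add_e]
    have hz1 : lo ≤ z + e pμ := le_trans hz (le_add_of_nonneg_right (e_nonneg pμ))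
    have hz2 : lo ≤ z + e pν := le_trans hz (le_add_of_nonneg_right (e_nonneg pν))
    have hzν : z + e pν ≤ hi := by
      calc z + e pν ≤ z + e pν + e pμ := le_add_of_nonneg_right (e_nonneg pμ)
        _ = z + e pμ + e pν := by abel
        _ ≤ hi := hzhi
    have hzμ : z + e pμ ≤ hi := hle_of_add _ pν hzhi
    by_cases hν : pν = ν
    · subst hν
      have hμne : pμ ≠ pν := ne_of_lt hpμν
      rw [hA_dir ⟨castSite z, pμ⟩ hμne, hA_dir ⟨castSite (z + e pν), pμ⟩ hμne, hA_val z hz hzν,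
        hA_val (z + e pμ) hz1 hzhi]
      by_cases hμ : pμ = μ
      · subst hμ
        rw [if_pos ⟨rfl, rfl⟩, Pi.add_apply, e_apply, if_pos rfl]
        push_cast
        ring
      · rw [if_neg fun h => hμ h.1]
        have : (z + e pμ) μ = z μ := by simp only [Pi.add_apply, e_apply, if_neg (Ne.symm hμ), add_zero]
        rw [this]
        ring
    · rw [if_neg fun h => hν h.2, hA_dir ⟨castSite (z + e pμ), pν⟩ hν, hA_dir ⟨castSite z, pν⟩ hν]
      by_cases hμ' : pμ = ν
      · subst hμ'
        rw [hA_val z hz hzμ, hA_val (z + e pν) hz2 (by rw [add_right_comm]; exact hzhi)]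
        have hne : pν ≠ μ := fun h => by subst h; exact lt_asymm hμν hpμν
        have : (z + e pν) μ = z μ := by simp only [Pi.add_apply, e_apply, if_neg (Ne.symm hne), add_zero]
        rw [this]
        ring
      · rw [hA_dir ⟨castSite z, pμ⟩ hμ', hA_dir ⟨castSite (z + e pν), pμ⟩ hμ']
        ring
  -- test the normal equations against `A`
  have hsum : ∑ p : Plaq P j, (if p.μ = μ ∧ p.ν = ν then r p else 0) =
      ∑ p : Plaq P j, r p * (A (slotBond p 0) + A (slotBond p 1) - A (slotBond p 2) - A (slotBond p 3)) := by
    refine Finset.sum_congr rfl fun p _ => ?_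
    by_cases hrp : r p = 0
    · simp [hrp]
    · rw [hcurl p (hr p hrp)]
      split_ifs <;> simp
  rw [hsum]
  exact H A hA_off

/-- The same conclusion from the UNRESTRICTED normal equations (the `hN` shape of (LIN-ID) v1: `r` pairs to zero with the curl of EVERY
bond field). [folklore] -/
theorem sum_ite_eq_zero_of_normalEq {lo hi : Fin P.d → ℤ} (hN : ∀ κ, hi κ - lo κ < P.sitesPerDir j)
    (r : Plaq P j → ℝ) (hr : ∀ p, r p ≠ 0 → p ∈ boxPlaqs lo hi)
    (H : ∀ B : PBond P j → ℝ,
      ∑ p : Plaq P j, r p * (B (slotBond p 0) + B (slotBond p 1) - B (slotBond p 2) - B (slotBond p 3)) = 0)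
    {μ ν : Fin P.d} (hμν : μ < ν) :
    ∑ p : Plaq P j, (if p.μ = μ ∧ p.ν = ν then r p else 0) = 0 :=
  sum_ite_eq_zero_of_offTree_normalEq hN r hr (fun B _ => H B) hμν

/-! ## §3  The obstruction: no box-local potential has least-squares normal equations against a net-flux weight -/

/-- ★★★ **THE OBSTRUCTION (off-tree form).**  If `w` is supported in the plaquettes of a non-wrapping box and has a NONZERO orientation
sum, then NO bond field `u` whose curl is supported in those plaquettes satisfies the off-tree normal equations
`Σ_p ((du)_p − w_p)·(dB)_p = 0` for all off-tree box-supported `B`: by §2 the orientation sum of `du − w` would vanish, by §1 that of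
`du` vanishes, so that of `w` would. [folklore] -/
theorem not_offTree_normalEq_of_orientationSum_ne_zero {lo hi : Fin P.d → ℤ} (hN : ∀ κ, hi κ - lo κ < P.sitesPerDir j)
    (w : Plaq P j → ℝ) (u : PBond P j → ℝ) (hw : ∀ p, w p ≠ 0 → p ∈ boxPlaqs lo hi)
    (hu : ∀ p : Plaq P j, u (slotBond p 0) + u (slotBond p 1) - u (slotBond p 2) - u (slotBond p 3) ≠ 0 → p ∈ boxPlaqs lo hi)
    {μ ν : Fin P.d} (hμν : μ < ν) (hflux : ∑ p : Plaq P j, (if p.μ = μ ∧ p.ν = ν then w p else 0) ≠ 0) :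
    ¬ ∀ B : PBond P j → ℝ,
        (∀ b, B b ≠ 0 → ∃ x : Fin P.d → ℤ, lo ≤ x ∧ x + e b.dir ≤ hi ∧ b.src = castSite x ∧ lowPart b.dir (x - lo) ≠ 0) →
        ∑ p : Plaq P j, ((u (slotBond p 0) + u (slotBond p 1) - u (slotBond p 2) - u (slotBond p 3)) - w p) *
          (B (slotBond p 0) + B (slotBond p 1) - B (slotBond p 2) - B (slotBond p 3)) = 0 := by
  intro H
  set r : Plaq P j → ℝ := fun p => (u (slotBond p 0) + u (slotBond p 1) - u (slotBond p 2) - u (slotBond p 3)) - w p with hr_def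
  have hr : ∀ p, r p ≠ 0 → p ∈ boxPlaqs lo hi := by
    intro p hp
    by_cases hwp : w p = 0
    · refine hu p ?_
      intro h0
      apply hp
      simp only [hr_def, h0, hwp, sub_zero]
    · exact hw p hwp
  have h1 := sum_ite_eq_zero_of_offTree_normalEq hN r hr (fun B hB => by simpa only [hr_def] using H B hB) hμν
  have h2 := sum_ite_curl_eq_zero u hμν
  apply hflux
  have h3 : ∑ p : Plaq P j, (if p.μ = μ ∧ p.ν = ν then w p else 0) =
      ∑ p : Plaq P j, (if p.μ = μ ∧ p.ν = ν then
          u (slotBond p 0) + u (slotBond p 1) - u (slotBond p 2) - u (slotBond p 3) else 0) -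
        ∑ p : Plaq P j, (if p.μ = μ ∧ p.ν = ν then r p else 0) := by
    rw [← Finset.sum_sub_distrib]
    refine Finset.sum_congr rfl fun p _ => ?_
    split_ifs
    · simp only [hr_def]; ring
    · simp
  rw [h3, h1, h2, sub_zero]

/-- ★★★ **THE OBSTRUCTION, in the EXACT letters of (LIN-ID) v1's hypothesis `hN`** (every `B : PBond P j → ℝ`, unrestricted): for `w`
supported in a non-wrapping box with a nonzero orientation sum and `u` with box-supported curl,
`¬ ∀ B, Σ_p ((du)_p − w_p)·(dB)_p = 0`. [folklore] -/
theorem not_normalEq_of_orientationSum_ne_zero {lo hi : Fin P.d → ℤ} (hN : ∀ κ, hi κ - lo κ < P.sitesPerDir j)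
    (w : Plaq P j → ℝ) (u : PBond P j → ℝ) (hw : ∀ p, w p ≠ 0 → p ∈ boxPlaqs lo hi)
    (hu : ∀ p : Plaq P j, u (slotBond p 0) + u (slotBond p 1) - u (slotBond p 2) - u (slotBond p 3) ≠ 0 → p ∈ boxPlaqs lo hi)
    {μ ν : Fin P.d} (hμν : μ < ν) (hflux : ∑ p : Plaq P j, (if p.μ = μ ∧ p.ν = ν then w p else 0) ≠ 0) :
    ¬ ∀ B : PBond P j → ℝ,
        ∑ p : Plaq P j, ((u (slotBond p 0) + u (slotBond p 1) - u (slotBond p 2) - u (slotBond p 3)) - w p) *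
          (B (slotBond p 0) + B (slotBond p 1) - B (slotBond p 2) - B (slotBond p 3)) = 0 :=
  fun H => not_offTree_normalEq_of_orientationSum_ne_zero hN w u hw hu hμν hflux fun B _ => H B

/-- Translation by `e_κ` is injective on the torus. [folklore] -/
theorem shift_injective (κ : Fin P.d) {a b : Site P j} (h : a.shift κ = b.shift κ) : a = b := by
  funext k
  have hk := congr_fun h k
  by_cases hkκ : k = κ
  · subst hkκ; simpa [Site.shift] using hk
  · simpa [Site.shift, Function.update_of_ne hkκ] using hk

/-- **MARGIN-1 SUPPORT ⇒ BOX-SUPPORTED CURL**: if `u` is supported on bonds `⟨castSite x, b.dir⟩` with `lo + 1 ≤ x` and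
`x + e_{b.dir} + 1 ≤ hi` (the support row of `stub_linTest`, with or without its off-tree clause), then `(du)_p ≠ 0` only on
plaquettes of `boxPlaqs lo hi` — every plaquette meeting such a bond has its four corners in the box. [folklore] -/
theorem curl_support_of_margin {lo hi : Fin P.d → ℤ} (u : PBond P j → ℝ)
    (hsupp : ∀ b, u b ≠ 0 → ∃ x : Fin P.d → ℤ, lo + 1 ≤ x ∧ x + e b.dir + 1 ≤ hi ∧ b.src = castSite x)
    (p : Plaq P j) (hp : u (slotBond p 0) + u (slotBond p 1) - u (slotBond p 2) - u (slotBond p 3) ≠ 0) :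
    p ∈ boxPlaqs lo hi := by
  -- one of the four slot bonds carries `u ≠ 0`
  have hex : u ⟨p.src, p.μ⟩ ≠ 0 ∨ u ⟨p.src.shift p.μ, p.ν⟩ ≠ 0 ∨ u ⟨p.src.shift p.ν, p.μ⟩ ≠ 0 ∨ u ⟨p.src, p.ν⟩ ≠ 0 := by
    by_contra hall
    push Not at hall
    obtain ⟨h0, h1, h2, h3⟩ := hall
    apply hp
    rw [curl_slotBond_eq, h0, h1, h2, h3]
    ring
  -- pointwise bounds on unit vectors
  have e_le : ∀ κ k : Fin P.d, e κ k ≤ 1 := fun κ k => by rw [e_apply]; split_ifs <;> norm_num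
  obtain ⟨src, pμ, pν, hpμν⟩ := p
  simp only at hex ⊢
  rcases hex with h | h | h | h
  · -- slot 0: `⟨x, μ⟩` with `src = castSite x`
    obtain ⟨x, hx, hxhi, hsrc⟩ := hsupp _ h
    simp only at hxhi hsrc
    refine ⟨x, fun k => ?_, fun k => ?_, hsrc⟩
    · show lo k ≤ x k
      have h1 : lo k + 1 ≤ x k := by simpa [Pi.add_apply] using hx k
      omega
    · show x k + e pμ k + e pν k ≤ hi k
      have h1 : x k + e pμ k + 1 ≤ hi k := by simpa [Pi.add_apply] using hxhi k
      have h2 := e_le pν k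
      omega
  · -- slot 1: `⟨x, ν⟩` with `src + e_μ = castSite x`
    obtain ⟨x, hx, hxhi, hsrc⟩ := hsupp _ h
    simp only at hxhi hsrc
    refine ⟨x - e pμ, fun k => ?_, fun k => ?_, ?_⟩
    · show lo k ≤ x k - e pμ k
      have h1 : lo k + 1 ≤ x k := by simpa [Pi.add_apply] using hx k
      have h2 := e_le pμ k
      omega
    · show x k - e pμ k + e pμ k + e pν k ≤ hi k
      have h1 : x k + e pν k + 1 ≤ hi k := by simpa [Pi.add_apply] using hxhi k
      omega
    · apply shift_injective pμ
      rw [hsrc, ← castSite_add_e, sub_add_cancel]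
  · -- slot 2: `⟨x, μ⟩` with `src + e_ν = castSite x`
    obtain ⟨x, hx, hxhi, hsrc⟩ := hsupp _ h
    simp only at hxhi hsrc
    refine ⟨x - e pν, fun k => ?_, fun k => ?_, ?_⟩
    · show lo k ≤ x k - e pν k
      have h1 : lo k + 1 ≤ x k := by simpa [Pi.add_apply] using hx k
      have h2 := e_le pν k
      omega
    · show x k - e pν k + e pμ k + e pν k ≤ hi k
      have h1 : x k + e pμ k + 1 ≤ hi k := by simpa [Pi.add_apply] using hxhi k
      omega
    · apply shift_injective pν
      rw [hsrc, ← castSite_add_e, sub_add_cancel]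
  · -- slot 3: `⟨x, ν⟩` with `src = castSite x`
    obtain ⟨x, hx, hxhi, hsrc⟩ := hsupp _ h
    simp only at hxhi hsrc
    refine ⟨x, fun k => ?_, fun k => ?_, hsrc⟩
    · show lo k ≤ x k
      have h1 : lo k + 1 ≤ x k := by simpa [Pi.add_apply] using hx k
      omega
    · show x k + e pμ k + e pν k ≤ hi k
      have h1 : x k + e pν k + 1 ≤ hi k := by simpa [Pi.add_apply] using hxhi k
      have h2 := e_le pμ k
      omega

/-- ★★★ **THE OBSTRUCTION FOR MARGIN-1 TEST FIELDS (the support row of `stub_linTest`)**: `w` supported in a non-wrapping box with a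
nonzero orientation sum, `u` supported with margin 1 inside the box ⇒ the normal equations `hN` are false. [folklore] -/
theorem not_normalEq_of_margin {lo hi : Fin P.d → ℤ} (hN : ∀ κ, hi κ - lo κ < P.sitesPerDir j)
    (w : Plaq P j → ℝ) (u : PBond P j → ℝ) (hw : ∀ p, w p ≠ 0 → p ∈ boxPlaqs lo hi)
    (hsupp : ∀ b, u b ≠ 0 → ∃ x : Fin P.d → ℤ, lo + 1 ≤ x ∧ x + e b.dir + 1 ≤ hi ∧ b.src = castSite x)
    {μ ν : Fin P.d} (hμν : μ < ν) (hflux : ∑ p : Plaq P j, (if p.μ = μ ∧ p.ν = ν then w p else 0) ≠ 0) :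
    ¬ ∀ B : PBond P j → ℝ,
        ∑ p : Plaq P j, ((u (slotBond p 0) + u (slotBond p 1) - u (slotBond p 2) - u (slotBond p 3)) - w p) *
          (B (slotBond p 0) + B (slotBond p 1) - B (slotBond p 2) - B (slotBond p 3)) = 0 :=
  not_normalEq_of_orientationSum_ne_zero hN w u hw (curl_support_of_margin u hsupp) hμν hflux

end Summit.QuantumFields.YangMills.Theorems.UnitScaleGibbsNormalEquationNetFlux

end
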